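/- Copyright: the b2b-balaban cell (near-miss cell 7), T⁴-continuum fan-out, lineage t4-ne7b-formalise-leaf-06 (NE7b CRUX
TEAM (2) leaf prover 06), gen 35: IR-49-2 «THE LATTICE-UNITS VOLUME WINDOW» (supply module).  Released under the licence of the surrounding project. -/
import Summits.QuantumFields.BalabanUV.T4Continuum.Support.HistoryBankingVolumeSupply

/-!
# History banking, M5-2 (c) supplier in PRINT'S CURRENCY (B): THE VOLUME LETTER IN LATTICE UNITS
`u_t = cΛ·(M·R_{t∧K})^d·ℓ_{t∧K}`, ITS GROWTH `(1+β₀)·L^d` ((2.7) + (2.9)), THE LATTICE WINDOW (gap `r(q′−d) − 1`), ITS THRESHOLD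
`ℓᵥᴸ`, AND M5-2c's calibration `VolumeDisplays` + `huV` DISCHARGED AT THAT LETTER (route R-P1 of row NE7b; INTERFACE REQUEST IR-49-2
of RULING R-OWNER-49-2 (3)(iii) «V-a»: SUPPLY MODULE ONLY — no record twin until the OWNER's M5-2d)

Summits-side support leaf of the T⁴-continuum cell (rung (B)+1 on a FINITE torus only; NOT infinite volume, NOT the mass gap,
NOT the Clay statement; NOT a proof of the spine estimate NE7b — the cell's OWN estimate, NOT PRINTED, NOT PROVED).  [folklore]
real arithmetic over the siblings `HistoryBankingVolumeWindow` (`uvol`, `jvol`, `hsmall_jvol`, `letter_mul_le_of_clause`,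
`ell_later_le_of_flowIneq27`, `structure VolumeDisplays`), `HistoryBankingRoundingWindow.envelope_of_isRj` (the UPPER (2.5) member
`R_j ≤ L·ℓ_j^{r}`), `HistoryBankingRoundingSupply` (`le_pow_of_rpow_inv_le`, `le_ell_of_coupling`), `HistoryBankingRoundingTuned`
`HistoryBankingSharpShares` (`ell`), the typed flow displays (2.5) `B14.IsRj`, (2.7) `B14.FlowIneq27`, (2.9) `B14FlowStep.FlowIneq29`
and the Literature prefix `Setup.Flow.InInterval`; no `[cite:]` tag, nothing printed asserted, no `def … : Prop`, zero `sorry`.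

WHY (R-OWNER-49-2 (3); refuter PRICING-NE7b v18 F96; leaf-06 g34 P-ne7bleaf06-g34-1).  The sibling pair IR-48-2 types print's p. 380
volume letter PER CUBE (`uvol cΛ g K t = cΛ·ℓ_{t∧K}`, growth `1 + β₀`, gap `r·q′ − 1`).  The CURRENCY OF RECORD is now (B) LATTICE
UNITS ([B16] p. 380 l. 15–18, p. 383 l. 24–26, (1.80) p. 384 — LOCATORS, the OWNER's currency reading, not a kernel fact): per
`M R_t`-cube of class one the level cost is `cΛ·(M·R_t)^d·ℓ_t`; the floor `floorK = E₂·R_t^{q′}` keeps its letter (`q′ = d+1`), so one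
power `R_t^d` of the letter is paid by the floor and only `R_t^{q′−d} ≥ ℓ_t^{r(q′−d)}` (LOWER (2.5) member) faces `ℓ_t`: gap
`κ₂ = r(q′−d) − 1` (= 1 at (r, q′, d) = (2, 5, 4), vs 9 per cube); the growth over a performed step is `(1+β₀)·L^d` ((2.7)
`ℓ_n ≤ (1+β₀)ℓ_m` AND (2.9)'s first member `R_n ≤ L·R_m`, `m < n ≤ K`), so M5-2c's lag is `jvol d ((1+β₀)L^d)`; the birth-credit
display `huV` reads the UPPER (2.5) member `R_j ≤ L·ℓ_j^{r}`: `2^{d+3}·cΛ·(L·M)^d·ℓ_j^{rd+1} ≤ θᵥ·A₀²·ℓ_j^{2p₀}`, gap `κᵥ = 2p₀ − rd − 1`.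
THIS FILE types that window and discharges M5-2c's eight calibration binders + `huV` at the lattice letter in the SAME shapes the (α)
record twin consumes from IR-48-2 (`VolumeDisplays … u Lu jl` at `Lu := (1+β₀)·L^d`, `jl := jvol d Lu`; `_of_log_eq` for a cost pinned
by a display `hΛ : log (Λ t) = uvolL …`; `_of_inInterval` under the headline's prefix at `e^{−ℓᵥᴸ∕2}`), so an LW-record variant (OWNER
M5-2d ∕ custodian) re-instantiates by name; M5-2c is met BY NAME through the sibling's `credit_mul_volume_le_shapeTH_of_volumeDisplays` ∘
(`volumeDisplaysL_of_log_eq`, `huVL_events_of_log_eq`); the WINDOW-FREE generics `uvolL_mul_le_of_clause` (any floor coefficient) and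
`coef_mul_letterL_le_credit` (any birth weight) serve the OWNER's M5-2d shrunk ledger (`huS` at `6·1122^d`, `huθ` at `cvol`) as well.

WHAT.  §1 **`uvolL`** (+ `uvolL_of_le`, `uvolL_eq_mul_uvol`, `uvolL_nonneg`).  §2 **`uvolL_later_le`** ∕ `uvolL_le_of_le` (growth
`(1+β₀)L^d` for EVERY `t ≤ n`).  §3 **`structure VolumeWindowL C d K r κ₂ κᵥ cΛ M L θᵥ Lu jl g`** (HYPOTHESIS SHAPE: `expF : 1 + κ₂ = r·(q′ − d)`,
`hdq : d ≤ q′`, `expV : 1 + r·d + κᵥ = 2p₀`, `1 ≤ ℓ_j`, (WV1ᴸ) `6(561^d·jl·Lu + 1122^d·Lu)·(cΛM^d) ≤ E₂·ℓ_j^{κ₂}`, (WV2ᴸ)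
`15·126^d·(cΛM^d) ≤ E₂·ℓ_j^{κ₂}`, (WV3ᴸ) `24·126^d·(cΛM^d) ≤ E₃·ℓ_j^{κ₂}`, (WV4ᴸ) `2^{d+3}·(cΛ(LM)^d) ≤ θᵥ·A₀²·ℓ_j^{κᵥ}`, `j ≤ K`);
`letterL_mul_le_of_clause`, **`uvolL_mul_le_of_clause`**, **`coef_mul_letterL_le_credit`** (window-free); **`huΦ_uvolL`**, **`huE₂_uvolL`**,
**`huE₃_uvolL`** (lower member), **`huV_uvolL`** (upper member), `huV_uvolL_of_isRj`.  §4 **`volumeDisplaysL_sharp : VolumeDisplays C d K R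
(uvolL cΛ M d g R K) ((1+β₀)·L^d) (jvol d ((1+β₀)·L^d))`**, **`volumeDisplaysL_sharp_of_isRj`** ((2.7) at any `p ≥ 1`, (2.9), (2.5) itself),
**`volumeDisplaysL_of_log_eq`**, **`huVL_of_log_eq`**, **`huVL_events_of_log_eq`**.  §5 **`ellVolL`** (the `max` of `1` and four real roots),
**`volumeWindowL_of_threshold`**, **`volumeWindowL_of_couplings`**, `exp_neg_ellVolL_pos`.  §6 **`volumeDisplaysL_sharp_of_couplings`**,
**`volumeDisplaysL_of_log_eq_of_inInterval`**, **`huVL_events_of_log_eq_of_inInterval`** (the fillers an LW-record variant with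
`hΛL : log (Φf.Λ K t) = uvolL cΛ M d (…flow.g) (ℛ.R K) K t` would consume, fed by `h27`, `h29`, `isRj`, exactly as IR-48-3 consumes IR-48-2's).

CENSUS NOTE (constants stay SYMBOLIC here, trigger c2∕c6; numbers = balaban-calc GRAMMAR v74 G37 «VOLUME-2» CERTIFIED, INBOX l.13562, which
re-derives leaf-06 g34's and refuter v18 F96's desk floats as exact integers).  At (d, r, q′, p₀, L, M) = (4, 2, 5, 23, 13, 13): `κ₂ = 1`, `κᵥ = 37`,
`Lu = 28561(1+β₀)`, `jvol 4 Lu = 78` for `β₀ < β⋆ = 2⁷³∕306306⁴ − 1 = 0.07292`; (WV1ᴸ) binds with `B₁(0) = 6·13⁴(561⁴·78 + 1122⁴) = 1.5955·10¹⁸`: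
`ℓᵥᴸ ≈ B₁(0)·13⁴·cΛ∕E₂ = 4.5570·10²²·cΛ∕E₂` (cell letters) `= 9.5101·10¹⁰·cΛ∕c_{E₂}` in print's units `E₂ = c_{E₂}M^d64^d` — ABOVE the binding
banking window of record `ℓ_w‴ = 436 … 565` (calc G31.4) by 8.23 … 8.34 orders unless `cΛ∕c_{E₂} ≤ 4.586·10⁻⁹`: under currency (B) WITH M5-2c's
FLAT LAG LEDGER the volume prefix is VACUOUS AT THE CENSUS LETTERS AS CHARGED (R-OWNER-49-2 (3)(ii): NOT a kill — an honest «for g ≤ γᵥᴸ»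
theorem; the located debt is the flat lag multiplicity; repair = the OWNER's M5-2d «shrunk-image volume ledger» (floor coefficient `6·1122^d`).

HONEST SCOPE.  Real arithmetic over OUR carriers; `VolumeWindowL` is a HYPOTHESIS shape (a smallness of OUR letters, reducible to
`g_j ≤ γ ≤ e^{−ℓᵥᴸ∕2}`); `cΛ`, `M` are displayed nonnegative reals, never numerals; nothing of H3 ∕ (B) ∕ BetaPertH is discharged.
Nothing of Bałaban's is asserted or contested.  NE7b NOT PRINTED ∕ NOT PROVED; spine 0∕9; rung (B)+1 on a FINITE torus — NOT infinite
volume, NOT the mass gap, NOT Clay.  HONEST DEPENDENCY (cell): continuum YM on T⁴ ⇐ BetaPertH ∧ nine spine estimates (0/9 proved);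
BetaPertH ⇐ (D1) ∧ (D4) ∧ CAP+tail; G-an2-4 gates asym, D1 and NE2/3/4.  This file changes none of it.
-/

open Finset
open Literature.MathematicalPhysics.QuantumFieldTheory.Balaban1983to89
open T4PersistenceDictionary T4PrintedShapeBanking T4Continuum
open Summit.QuantumFields.BalabanUV.T4Continuum.HistoryConstants
open Summit.QuantumFields.BalabanUV.T4Continuum.HistoryBankingSharpShares
open Summit.QuantumFields.BalabanUV.T4Continuum.HistoryBankingRoundingWindow (envelope_of_isRj)
open Summit.QuantumFields.BalabanUV.T4Continuum.HistoryBankingRoundingSupply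
open Summit.QuantumFields.BalabanUV.T4Continuum.HistoryBankingVolumeWindow
open Summit.QuantumFields.BalabanUV.T4Continuum.HistoryBankingVolumeSupply

namespace Summit.QuantumFields.BalabanUV.T4Continuum.HistoryBankingVolumeWindowLattice

noncomputable section

/-! ## §1 The letter in lattice units -/
section Letters

/-- **PRINT'S VOLUME LETTER IN LATTICE UNITS** (currency (B) of RULING R-OWNER-49-2; per `M·R_t`-cube of class one, the level
capped at the cutoff): `uvolL cΛ M d g R K t = cΛ·(M·R_{t∧K})^d·ℓ_{t∧K}`, `ℓ_j = log g_j⁻²` — [B16] p. 380 l. 15–18 «O(1) log g_j⁻²|Z_j|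
≤ O(1) log g_j⁻²(MR_j)^d d′_j» (LOCATOR; `cΛ` the displayed `O(1)`, `M` print's block constant, `R` the reading's sizes); capped at `K`. [folklore] -/
def uvolL (cΛ M : ℝ) (d : ℕ) (g : ℕ → ℝ) (R : ℕ → ℕ) (K t : ℕ) : ℝ := cΛ * (M * R (min t K)) ^ d * ell g (min t K)

variable {cΛ M : ℝ} {d : ℕ} {g : ℕ → ℝ} {R : ℕ → ℕ} {K : ℕ}

/-- on the performed range the letter is `cΛ·(M·R_t)^d·ℓ_t`. [folklore] -/
theorem uvolL_of_le (cΛ M : ℝ) (d : ℕ) (g : ℕ → ℝ) (R : ℕ → ℕ) {K t : ℕ} (ht : t ≤ K) :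
    uvolL cΛ M d g R K t = cΛ * (M * R t) ^ d * ell g t := by rw [uvolL, min_eq_left ht]

/-- **THE LATTICE LETTER IS THE PER-CUBE LETTER TIMES THE SITE COUNT**: `uvolL = (M·R_{t∧K})^d·uvol` (G-M5-2's two currencies). [folklore] -/
theorem uvolL_eq_mul_uvol (t : ℕ) : uvolL cΛ M d g R K t = (M * R (min t K)) ^ d * uvol cΛ g K t := by unfold uvolL uvol; ring

/-- the letter is nonnegative (`cΛ, M ≥ 0`, `ℓ_j ≥ 1` on the performed range). [folklore] -/
theorem uvolL_nonneg (hc : 0 ≤ cΛ) (hM : 0 ≤ M) (hℓ : ∀ j, j ≤ K → 1 ≤ ell g j) (t : ℕ) : 0 ≤ uvolL cΛ M d g R K t :=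
  mul_nonneg (mul_nonneg hc (pow_nonneg (mul_nonneg hM (Nat.cast_nonneg _)) _)) (zero_le_one.trans (hℓ _ (min_le_right t K)))

end Letters

/-! ## §2 (2.7) + (2.9): the capped lattice letter grows by at most `(1+β₀)·L^d` — `hLu` for every lag -/
section Growth

variable {g : ℕ → ℝ} {R : ℕ → ℕ} {β₀ cΛ M : ℝ} {K L d : ℕ}

/-- **`hLu` AT THE LATTICE LETTER, FOR EVERY LAG**: if `ℓ_n ≤ (1+β₀)·ℓ_m` ((2.7)) and `R_n ≤ L·R_m` ((2.9), first member) for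
`m < n ≤ K`, `β₀, cΛ, M ≥ 0`, `L ≥ 1`, `ℓ ≥ 1` on the performed range: `uvolL … (t+i) ≤ (1+β₀)·L^d·uvolL … t` for ALL `t, i`. [folklore] -/
theorem uvolL_later_le (hmono : ∀ m n, m < n → n ≤ K → ell g n ≤ (1 + β₀) * ell g m)
    (hRmono : ∀ m n, m < n → n ≤ K → (R n : ℝ) ≤ L * R m) (hβ₀ : 0 ≤ β₀) (hc : 0 ≤ cΛ) (hM : 0 ≤ M) (hL : 1 ≤ L)
    (hℓ : ∀ j, j ≤ K → 1 ≤ ell g j) (t i : ℕ) : uvolL cΛ M d g R K (t + i) ≤ (1 + β₀) * L ^ d * uvolL cΛ M d g R K t := by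
  have hle : min t K ≤ min (t + i) K := min_le_min_right K (Nat.le_add_right t i)
  have hu0 : 0 ≤ uvolL cΛ M d g R K t := uvolL_nonneg hc hM hℓ t
  rcases hle.eq_or_lt with heq | hlt
  · have h1 : (1 : ℝ) ≤ (1 + β₀) * L ^ d := one_le_mul_of_one_le_of_one_le (by linarith) (one_le_pow₀ (by exact_mod_cast hL))
    unfold uvolL at hu0 ⊢
    rw [← heq]; exact le_mul_of_one_le_left hu0 h1
  · have hK : min (t + i) K ≤ K := min_le_right _ _
    have hpow : (M * R (min (t + i) K)) ^ d ≤ (L * (M * R (min t K))) ^ d := by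
      apply pow_le_pow_left₀ (mul_nonneg hM (Nat.cast_nonneg _))
      calc M * (R (min (t + i) K) : ℝ) ≤ M * (L * R (min t K)) := mul_le_mul_of_nonneg_left (hRmono _ _ hlt hK) hM
        _ = L * (M * R (min t K)) := by ring
    unfold uvolL
    calc cΛ * (M * R (min (t + i) K)) ^ d * ell g (min (t + i) K)
        ≤ cΛ * (L * (M * R (min t K))) ^ d * ((1 + β₀) * ell g (min t K)) :=
          mul_le_mul (mul_le_mul_of_nonneg_left hpow hc) (hmono _ _ hlt hK) (zero_le_one.trans (hℓ _ hK))
            (mul_nonneg hc (pow_nonneg (mul_nonneg (Nat.cast_nonneg _) (mul_nonneg hM (Nat.cast_nonneg _))) _))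
      _ = (1 + β₀) * L ^ d * (cΛ * (M * R (min t K)) ^ d * ell g (min t K)) := by rw [mul_pow]; ring

/-- the same in the CUMULATIVE shape `∀ t n, t ≤ n → u n ≤ Γ·u t` of the OWNER's M5-2d `hΓ` (`Γ := (1+β₀)·L^d`). [folklore] -/
theorem uvolL_le_of_le (hmono : ∀ m n, m < n → n ≤ K → ell g n ≤ (1 + β₀) * ell g m)
    (hRmono : ∀ m n, m < n → n ≤ K → (R n : ℝ) ≤ L * R m) (hβ₀ : 0 ≤ β₀) (hc : 0 ≤ cΛ) (hM : 0 ≤ M) (hL : 1 ≤ L)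
    (hℓ : ∀ j, j ≤ K → 1 ≤ ell g j) {t n : ℕ} (htn : t ≤ n) : uvolL cΛ M d g R K n ≤ (1 + β₀) * L ^ d * uvolL cΛ M d g R K t := by
  obtain ⟨i, rfl⟩ := Nat.exists_eq_add_of_le htn; exact uvolL_later_le hmono hRmono hβ₀ hc hM hL hℓ t i

end Growth

/-! ## §3 The lattice window (HYPOTHESIS SHAPE) and the four value displays at the letter -/
section Window

/-- **THE LATTICE-UNITS VOLUME WINDOW** (HYPOTHESIS SHAPE — a `ForSmallCouplings`-type smallness of the run's couplings, K-UNIFORM;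
§5 reduces it to ONE threshold `ℓ_j ≥ ℓᵥᴸ`, hence to `g_j ≤ γ ≤ e^{−ℓᵥᴸ∕2}`).  Letters: `r` the (2.5) exponent, `C.q′` the floor power,
`C.p₀`∕`C.A₀` the profile, `cΛ ≥ 0`, `M ≥ 0`, `L` the blocking parameter (of (2.9) and (2.5)), `θᵥ` the volume slack of the END,
`Lu`∕`jl` the calibration read at (of record `Lu = (1+β₀)·L^d`, `jl = jvol d Lu`); gaps `1 + κ₂ = r·(q′ − d)` (the letter's `R^d·ℓ`
against the floor's `R^{q′} ≥ R^d·ℓ^{r(q′−d)}`), `1 + r·d + κᵥ = 2p₀` (`(LM)^d·ℓ^{rd+1}` against `A₀²ℓ^{2p₀}`).  Clauses (`j ≤ K`): (WV1ᴸ)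
the flat ledger's per-step charge, (WV2ᴸ)∕(WV3ᴸ) the young-birth ∕ size charges — at `cΛ·M^d`; (WV4ᴸ) the class-linear volume
remainder — at `cΛ·(L·M)^d`.  Nothing of Bałaban's asserted: a smallness of OUR letters. [folklore] -/
structure VolumeWindowL (C : T4PrintedShapeBanking.Consts) (d K r κ₂ κᵥ : ℕ) (cΛ M : ℝ) (L : ℕ) (θv Lu : ℝ) (jl : ℕ) (g : ℕ → ℝ) :
    Prop where
  /-- exponent bookkeeping against the floor: `1 + κ₂ = r·(q′ − d)` -/
  expF : 1 + κ₂ = r * (C.q' - d)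
  /-- the floor power dominates the dimension: `d ≤ q′` (print: `q′ = d + 1`) -/
  hdq : d ≤ C.q'
  /-- exponent bookkeeping against the quadratic birth credit: `1 + r·d + κᵥ = 2p₀` -/
  expV : 1 + r * d + κᵥ = 2 * C.p₀
  /-- the logarithms are at least one on the performed range -/
  one_le_ell : ∀ j, j ≤ K → 1 ≤ ell g j
  /-- (WV1ᴸ) -/
  wΦ : ∀ j, j ≤ K → 6 * (561 ^ d * jl * Lu + 1122 ^ d * Lu) * (cΛ * M ^ d) ≤ C.E₂ * ell g j ^ κ₂
  /-- (WV2ᴸ) -/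
  wE₂ : ∀ j, j ≤ K → 15 * 126 ^ d * (cΛ * M ^ d) ≤ C.E₂ * ell g j ^ κ₂
  /-- (WV3ᴸ) -/
  wE₃ : ∀ j, j ≤ K → 24 * 126 ^ d * (cΛ * M ^ d) ≤ C.E₃ * ell g j ^ κ₂
  /-- (WV4ᴸ) -/
  wV : ∀ j, j ≤ K → 2 ^ (d + 3) * (cΛ * (L * M) ^ d) ≤ θv * C.A₀ ^ 2 * ell g j ^ κᵥ

variable {C : T4PrintedShapeBanking.Consts} {d K r κ₂ κᵥ L jl : ℕ} {cΛ M θv Lu : ℝ} {g : ℕ → ℝ} {R : ℕ → ℕ}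

/-- one clause step in lattice units: from `a·(cΛ·M^d) ≤ E·ℓ^{κ}`, `1 + κ = r·e`, `ℓ, ρ, E ≥ 0` and the lower (2.5) member
`ℓ^{r} ≤ ρ`: `cΛ·(M·ρ)^d·ℓ·a ≤ E·ρ^{e+d}` (one power `ρ^d` of the letter passes through). [folklore] -/
theorem letterL_mul_le_of_clause {a E ℓ ρ : ℝ} {κ e : ℕ} (hexp : 1 + κ = r * e) (hℓ : 0 ≤ ℓ) (hρ : 0 ≤ ρ) (hE : 0 ≤ E)
    (hlow : ℓ ^ r ≤ ρ) (h : a * (cΛ * M ^ d) ≤ E * ℓ ^ κ) : cΛ * (M * ρ) ^ d * ℓ * a ≤ E * ρ ^ (e + d) := by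
  have h1 : cΛ * M ^ d * ℓ * a ≤ E * ℓ ^ (r * e) := letter_mul_le_of_clause hexp hℓ h
  have h2 : ℓ ^ (r * e) ≤ ρ ^ e := by rw [pow_mul]; exact pow_le_pow_left₀ (pow_nonneg hℓ _) hlow e
  have hρd : 0 ≤ ρ ^ d := pow_nonneg hρ _
  calc cΛ * (M * ρ) ^ d * ℓ * a = cΛ * M ^ d * ℓ * a * ρ ^ d := by rw [mul_pow]; ring
    _ ≤ E * ℓ ^ (r * e) * ρ ^ d := mul_le_mul_of_nonneg_right h1 hρd
    _ ≤ E * ρ ^ e * ρ ^ d := mul_le_mul_of_nonneg_right (mul_le_mul_of_nonneg_left h2 hE) hρd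
    _ = E * ρ ^ (e + d) := by rw [pow_add]; ring

/-- GENERIC FLOOR-TYPE STEP (window-free; reused by the shrunk-ledger supplier): a clause `a·(cΛ·M^d) ≤ E·ℓ_n^{κ}` with
`1 + κ = r·(q′ − d)`, `d ≤ q′`, `E ≥ 0`, `ℓ_n ≥ 0` and the lower (2.5) member `ℓ_n^{r} ≤ R_n` at a performed step `n ≤ K` gives
`uvolL … n·a ≤ E·R_n^{q′}`. [folklore] -/
theorem uvolL_mul_le_of_clause {κ : ℕ} (hexp : 1 + κ = r * (C.q' - d)) (hdq : d ≤ C.q') {a E : ℝ} (hE : 0 ≤ E) {n : ℕ}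
    (hn : n ≤ K) (hℓ : 0 ≤ ell g n) (hlow : ell g n ^ r ≤ (R n : ℝ)) (h : a * (cΛ * M ^ d) ≤ E * ell g n ^ κ) :
    uvolL cΛ M d g R K n * a ≤ E * (R n : ℝ) ^ C.q' := by
  rw [uvolL_of_le cΛ M d g R hn]
  have h' := letterL_mul_le_of_clause hexp hℓ (Nat.cast_nonneg (R n)) hE hlow h
  rwa [Nat.sub_add_cancel hdq] at h'

/-- **`huΦ` AT THE LATTICE LETTER**: under the window, `E₂ ≥ 0` and the lower (2.5) member `ℓ_t^{r} ≤ R_t` (`t ≤ K`):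
`uvolL … t·6(561^d·jl·Lu + 1122^d·Lu) ≤ floorK C K R t` for `t ≤ K`. [folklore] -/
theorem huΦ_uvolL (hW : VolumeWindowL C d K r κ₂ κᵥ cΛ M L θv Lu jl g) (hE₂ : 0 ≤ C.E₂)
    (hlow : ∀ t, t ≤ K → ell g t ^ r ≤ (R t : ℝ)) (t : ℕ) (ht : t ≤ K) :
    uvolL cΛ M d g R K t * (6 * (561 ^ d * jl * Lu + 1122 ^ d * Lu)) ≤ floorK C K R t := by
  rw [floorK, if_pos ht]
  exact uvolL_mul_le_of_clause hW.expF hW.hdq hE₂ ht (zero_le_one.trans (hW.one_le_ell t ht)) (hlow t ht) (hW.wΦ t ht)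

/-- **`huE₂` AT THE LATTICE LETTER**: `uvolL … n·15·126^d ≤ E₂·R_n^{q′}` for `n ≤ K`. [folklore] -/
theorem huE₂_uvolL (hW : VolumeWindowL C d K r κ₂ κᵥ cΛ M L θv Lu jl g) (hE₂ : 0 ≤ C.E₂)
    (hlow : ∀ t, t ≤ K → ell g t ^ r ≤ (R t : ℝ)) (n : ℕ) (hn : n ≤ K) :
    uvolL cΛ M d g R K n * (15 * 126 ^ d) ≤ C.E₂ * (R n : ℝ) ^ C.q' :=
  uvolL_mul_le_of_clause hW.expF hW.hdq hE₂ hn (zero_le_one.trans (hW.one_le_ell n hn)) (hlow n hn) (hW.wE₂ n hn)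

/-- **`huE₃` AT THE LATTICE LETTER**: `uvolL … n·24·126^d ≤ E₃·R_n^{q′}` for `n ≤ K` (`E₃ ≥ 0`). [folklore] -/
theorem huE₃_uvolL (hW : VolumeWindowL C d K r κ₂ κᵥ cΛ M L θv Lu jl g) (hE₃ : 0 ≤ C.E₃)
    (hlow : ∀ t, t ≤ K → ell g t ^ r ≤ (R t : ℝ)) (n : ℕ) (hn : n ≤ K) :
    uvolL cΛ M d g R K n * (24 * 126 ^ d) ≤ C.E₃ * (R n : ℝ) ^ C.q' :=
  uvolL_mul_le_of_clause hW.expF hW.hdq hE₃ hn (zero_le_one.trans (hW.one_le_ell n hn)) (hlow n hn) (hW.wE₃ n hn)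

/-- GENERIC BIRTH-CREDIT STEP (window-free, any weight `a ≥ 0`; reused by the shrunk-ledger supplier at `a := cvol …`): a clause
`a·(cΛ·(L·M)^d) ≤ θ·A₀²·ℓ_j^{κ}` with `1 + r·d + κ = 2p₀`, `cΛ, M ≥ 0`, `ℓ_j ≥ 0` and the UPPER (2.5) member `R_j ≤ L·ℓ_j^{r}` gives
`a·(cΛ·(M·R_j)^d·ℓ_j) ≤ θ·p₀(g_j)²`. [folklore] -/
theorem coef_mul_letterL_le_credit {κ : ℕ} (hexpV : 1 + r * d + κ = 2 * C.p₀) {a : ℝ} (ha : 0 ≤ a) (hc : 0 ≤ cΛ) (hM : 0 ≤ M)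
    {j : ℕ} (hℓ : 0 ≤ ell g j) (hup : (R j : ℝ) ≤ L * ell g j ^ r) (h : a * (cΛ * (L * M) ^ d) ≤ θv * C.A₀ ^ 2 * ell g j ^ κ) :
    a * (cΛ * (M * R j) ^ d * ell g j) ≤ θv * p0Profile C.A₀ C.p₀ (g j) ^ 2 := by
  rw [p0Profile_eq]
  have h1 : (M * R j) ^ d ≤ (L * M) ^ d * ell g j ^ (r * d) := by
    rw [pow_mul, ← mul_pow]
    apply pow_le_pow_left₀ (mul_nonneg hM (Nat.cast_nonneg _))
    calc M * (R j : ℝ) ≤ M * (L * ell g j ^ r) := mul_le_mul_of_nonneg_left hup hM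
      _ = L * M * ell g j ^ r := by ring
  have h3 : θv * C.A₀ ^ 2 * ell g j ^ κ * ell g j ^ (r * d + 1) = θv * (C.A₀ * ell g j ^ C.p₀) ^ 2 := by
    rw [mul_pow, ← pow_mul, show C.p₀ * 2 = κ + (r * d + 1) by omega, pow_add]; ring
  calc a * (cΛ * (M * R j) ^ d * ell g j) ≤ a * (cΛ * ((L * M) ^ d * ell g j ^ (r * d)) * ell g j) :=
        mul_le_mul_of_nonneg_left (mul_le_mul_of_nonneg_right (mul_le_mul_of_nonneg_left h1 hc) hℓ) ha
    _ = a * (cΛ * (L * M) ^ d) * ell g j ^ (r * d + 1) := by rw [pow_succ]; ring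
    _ ≤ θv * C.A₀ ^ 2 * ell g j ^ κ * ell g j ^ (r * d + 1) := mul_le_mul_of_nonneg_right h (pow_nonneg hℓ _)
    _ = θv * (C.A₀ * ell g j ^ C.p₀) ^ 2 := h3

/-- **`huV` AT THE LATTICE LETTER** (the volume-slack display, per performed birth step), from the UPPER (2.5) member
`R_j ≤ L·ℓ_j^{r}` (`j ≤ K`), `cΛ, M ≥ 0`: `2^{d+3}·uvolL … j ≤ θᵥ·p₀(g_j)²` for `j ≤ K`. [folklore] -/
theorem huV_uvolL (hW : VolumeWindowL C d K r κ₂ κᵥ cΛ M L θv Lu jl g) (hc : 0 ≤ cΛ) (hM : 0 ≤ M)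
    (hup : ∀ j, j ≤ K → (R j : ℝ) ≤ L * ell g j ^ r) (j : ℕ) (hj : j ≤ K) :
    2 ^ (d + 3) * uvolL cΛ M d g R K j ≤ θv * p0Profile C.A₀ C.p₀ (g j) ^ 2 := by
  rw [uvolL_of_le cΛ M d g R hj]
  exact coef_mul_letterL_le_credit hW.expV (by positivity) hc hM (zero_le_one.trans (hW.one_le_ell j hj)) (hup j hj) (hW.wV j hj)

/-- `huV` at the lattice letter FROM (2.5) ITSELF (`B14.IsRj`, `L ≥ 1`; upper member by `HistoryBankingRoundingWindow.envelope_of_isRj`). [folklore] -/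
theorem huV_uvolL_of_isRj (hW : VolumeWindowL C d K r κ₂ κᵥ cΛ M L θv Lu jl g) (hc : 0 ≤ cΛ) (hM : 0 ≤ M) (hL : 1 ≤ L)
    (hRj : ∀ t, t ≤ K → B14.IsRj L r (g t) (R t)) (j : ℕ) (hj : j ≤ K) :
    2 ^ (d + 3) * uvolL cΛ M d g R K j ≤ θv * p0Profile C.A₀ C.p₀ (g j) ^ 2 :=
  huV_uvolL hW hc hM (fun t ht => (envelope_of_isRj hL (hRj t ht) (hW.one_le_ell t ht)).1) j hj

end Window

/-! ## §4 M5-2c's calibration bundle DISCHARGED at the lattice letter (`Lu := (1+β₀)·L^d`, `jl := jvol d Lu`) -/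
section Displays

variable {C : T4PrintedShapeBanking.Consts} {d K r κ₂ κᵥ L p : ℕ} {cΛ M θv β' β'' β₀ β₀'' : ℝ} {g : ℕ → ℝ} {R : ℕ → ℕ}

/-- **THE VOLUME CALIBRATION DISCHARGED AT THE LATTICE LETTER**: with (2.7)'s consequence `ℓ_n ≤ (1+β₀)ℓ_m` and (2.9)'s first
member `R_n ≤ L·R_m` (`m < n ≤ K`), `β₀, cΛ, M ≥ 0`, `L ≥ 1`, `E₂, E₃ ≥ 0`, the lower (2.5) member `ℓ_t^{r} ≤ R_t` (`t ≤ K`) and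
the lattice window read at `Lu := (1+β₀)·L^d`, `jl := jvol d Lu`: M5-2c's eight calibration binders at `u := uvolL …`. [folklore] -/
theorem volumeDisplaysL_sharp (hmono : ∀ m n, m < n → n ≤ K → ell g n ≤ (1 + β₀) * ell g m)
    (hRmono : ∀ m n, m < n → n ≤ K → (R n : ℝ) ≤ L * R m) (hβ₀ : 0 ≤ β₀) (hc : 0 ≤ cΛ) (hM : 0 ≤ M) (hL : 1 ≤ L)
    (hE₂ : 0 ≤ C.E₂) (hE₃ : 0 ≤ C.E₃) (hlow : ∀ t, t ≤ K → ell g t ^ r ≤ (R t : ℝ))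
    (hW : VolumeWindowL C d K r κ₂ κᵥ cΛ M L θv ((1 + β₀) * L ^ d) (jvol d ((1 + β₀) * L ^ d)) g) :
    VolumeDisplays C d K R (uvolL cΛ M d g R K) ((1 + β₀) * L ^ d) (jvol d ((1 + β₀) * L ^ d)) where
  hu := uvolL_nonneg hc hM hW.one_le_ell
  hLu0 := mul_pos (by linarith) (pow_pos (Nat.cast_pos.2 (Nat.lt_of_lt_of_le Nat.zero_lt_one hL)) _)
  hj1 := one_le_jvol d _
  hLu t i _ := uvolL_later_le hmono hRmono hβ₀ hc hM hL hW.one_le_ell t i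
  hsmall := hsmall_jvol d _
  huΦ := huΦ_uvolL hW hE₂ hlow
  huE₂ := huE₂_uvolL hW hE₂ hlow
  huE₃ := huE₃_uvolL hW hE₃ hlow

/-- the same from (2.7) at any exponent `p ≥ 1` (`B14.FlowIneq27 g β′ β₀ p K`), (2.9) (`B14FlowStep.FlowIneq29 R g L …`, first
member) and (2.5) itself (`B14.IsRj L r (g_t) (R_t)`, `t ≤ K`, whose second conjunct IS the lower member). [folklore] -/
theorem volumeDisplaysL_sharp_of_isRj (hp : 1 ≤ p) (h27 : B14.FlowIneq27 g β' β₀ p K)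
    (h29 : B14FlowStep.FlowIneq29 R g L β'' β₀'' K) (hβ₀ : 0 ≤ β₀) (hc : 0 ≤ cΛ) (hM : 0 ≤ M) (hL : 1 ≤ L) (hE₂ : 0 ≤ C.E₂)
    (hE₃ : 0 ≤ C.E₃) (hRj : ∀ t, t ≤ K → B14.IsRj L r (g t) (R t))
    (hW : VolumeWindowL C d K r κ₂ κᵥ cΛ M L θv ((1 + β₀) * L ^ d) (jvol d ((1 + β₀) * L ^ d)) g) :
    VolumeDisplays C d K R (uvolL cΛ M d g R K) ((1 + β₀) * L ^ d) (jvol d ((1 + β₀) * L ^ d)) :=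
  volumeDisplaysL_sharp
    (fun _ _ hmn hn => ell_later_le_of_flowIneq27 hp h27 hβ₀ (fun j hj => zero_le_one.trans (hW.one_le_ell j hj)) hmn hn)
    (fun _ _ hmn hn => (h29 _ _ hmn hn).1) hβ₀ hc hM hL hE₂ hE₃ (fun t ht => by obtain ⟨_, _, h, _⟩ := hRj t ht; exact h) hW

/-- **THE RECORD-FACING FORM** (a per-cube cost PINNED by a display `hΛ : log (Λ t) = uvolL cΛ M d g R K t`): LITERALLY the record
fields `hLu0 ∕ hj1 ∕ hLu ∕ hsmall ∕ huΦ ∕ huE₂ ∕ huE₃` at the cutoff `K` with `Lu K := (1+β₀)·L^d`, `jl K := jvol d ((1+β₀)·L^d)`. [folklore] -/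
theorem volumeDisplaysL_of_log_eq {Λ : ℕ → ℝ} (hΛ : ∀ t, Real.log (Λ t) = uvolL cΛ M d g R K t)
    (hmono : ∀ m n, m < n → n ≤ K → ell g n ≤ (1 + β₀) * ell g m)
    (hRmono : ∀ m n, m < n → n ≤ K → (R n : ℝ) ≤ L * R m) (hβ₀ : 0 ≤ β₀) (hc : 0 ≤ cΛ) (hM : 0 ≤ M) (hL : 1 ≤ L)
    (hE₂ : 0 ≤ C.E₂) (hE₃ : 0 ≤ C.E₃) (hlow : ∀ t, t ≤ K → ell g t ^ r ≤ (R t : ℝ))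
    (hW : VolumeWindowL C d K r κ₂ κᵥ cΛ M L θv ((1 + β₀) * L ^ d) (jvol d ((1 + β₀) * L ^ d)) g) :
    VolumeDisplays C d K R (fun t => Real.log (Λ t)) ((1 + β₀) * L ^ d) (jvol d ((1 + β₀) * L ^ d)) := by
  rw [show (fun t => Real.log (Λ t)) = uvolL cΛ M d g R K from funext hΛ]
  exact volumeDisplaysL_sharp hmono hRmono hβ₀ hc hM hL hE₂ hE₃ hlow hW

/-- **`huV` IN THE RECORD's SHAPE** for a cost pinned at the lattice letter: `2^{d+3}·log (Λ j) ≤ θᵥ·p₀(g_j)²` at every performed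
step `j ≤ K` (upper (2.5) member `hup`). [folklore] -/
theorem huVL_of_log_eq {Lu : ℝ} {jl : ℕ} {Λ : ℕ → ℝ} (hΛ : ∀ t, Real.log (Λ t) = uvolL cΛ M d g R K t)
    (hW : VolumeWindowL C d K r κ₂ κᵥ cΛ M L θv Lu jl g) (hc : 0 ≤ cΛ) (hM : 0 ≤ M) (hup : ∀ j, j ≤ K → (R j : ℝ) ≤ L * ell g j ^ r)
    (j : ℕ) (hj : j ≤ K) : 2 ^ (d + 3) * Real.log (Λ j) ≤ θv * p0Profile C.A₀ C.p₀ (g j) ^ 2 := by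
  rw [hΛ]; exact huV_uvolL hW hc hM hup j hj

/-- `huV` lifted to a finite family of events read through `sh` (kind-`0` events at performed steps): M5-2c's `huθ` shape. [folklore] -/
theorem huVL_events_of_log_eq {ε : Type*} {Lu : ℝ} {jl : ℕ} {Λ : ℕ → ℝ} (hΛ : ∀ t, Real.log (Λ t) = uvolL cΛ M d g R K t)
    (hW : VolumeWindowL C d K r κ₂ κᵥ cΛ M L θv Lu jl g) (hc : 0 ≤ cΛ) (hM : 0 ≤ M) (hup : ∀ j, j ≤ K → (R j : ℝ) ≤ L * ell g j ^ r)
    (sh : ε → PEv) (E : Finset ε) (hsteps : ∀ e ∈ E, (sh e).kind = 0 → (sh e).step ≤ K) :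
    ∀ e ∈ E, (sh e).kind = 0 → 2 ^ (d + 3) * Real.log (Λ (sh e).step) ≤ θv * p0Profile C.A₀ C.p₀ (g (sh e).step) ^ 2 :=
  fun e he h0 => huVL_of_log_eq hΛ hW hc hM hup _ (hsteps e he h0)

end Displays

/-! ## §5 ONE threshold `ℓᵥᴸ` and the coupling form `g_j ≤ γ ≤ e^{−ℓᵥᴸ∕2}` -/
section Threshold

/-- **THE LATTICE VOLUME THRESHOLD** `ℓᵥᴸ = max{1, (6(561^d·jl·Lu + 1122^d·Lu)·cΛM^d∕E₂)^{1∕κ₂}, (15·126^d·cΛM^d∕E₂)^{1∕κ₂},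
(24·126^d·cΛM^d∕E₃)^{1∕κ₂}, (2^{d+3}·cΛ(LM)^d∕(θᵥA₀²))^{1∕κᵥ}}` (real roots; a closed-form function of the constants and of the
calibration the clauses are read at). [folklore] -/
def ellVolL (C : T4PrintedShapeBanking.Consts) (d κ₂ κᵥ : ℕ) (cΛ M : ℝ) (L : ℕ) (θv Lu : ℝ) (jl : ℕ) : ℝ :=
  max 1 (max
    (max ((6 * (561 ^ d * jl * Lu + 1122 ^ d * Lu) * (cΛ * M ^ d) / C.E₂) ^ ((1 : ℝ) / κ₂))
      ((15 * 126 ^ d * (cΛ * M ^ d) / C.E₂) ^ ((1 : ℝ) / κ₂)))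
    (max ((24 * 126 ^ d * (cΛ * M ^ d) / C.E₃) ^ ((1 : ℝ) / κ₂))
      ((2 ^ (d + 3) * (cΛ * (L * M) ^ d) / (θv * C.A₀ ^ 2)) ^ ((1 : ℝ) / κᵥ))))

variable {C : T4PrintedShapeBanking.Consts} {d K r κ₂ κᵥ L jl : ℕ} {cΛ M θv Lu : ℝ} {g : ℕ → ℝ}

/-- **THE LATTICE WINDOW FROM ONE THRESHOLD**: `ℓᵥᴸ ≤ ℓ_j` for every `j ≤ K` (gaps `≥ 1`, signs) gives `VolumeWindowL …`. [folklore] -/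
theorem volumeWindowL_of_threshold (hexpF : 1 + κ₂ = r * (C.q' - d)) (hdq : d ≤ C.q') (hexpV : 1 + r * d + κᵥ = 2 * C.p₀)
    (hκ₂ : 1 ≤ κ₂) (hκᵥ : 1 ≤ κᵥ) (hc : 0 ≤ cΛ) (hM : 0 ≤ M) (hE₂ : 0 < C.E₂) (hE₃ : 0 < C.E₃) (hθ : 0 < θv)
    (hA₀ : C.A₀ ≠ 0) (hLu : 0 ≤ Lu) (hwin : ∀ j, j ≤ K → ellVolL C d κ₂ κᵥ cΛ M L θv Lu jl ≤ ell g j) :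
    VolumeWindowL C d K r κ₂ κᵥ cΛ M L θv Lu jl g := by
  have hA2 : 0 < θv * C.A₀ ^ 2 := by positivity
  have hΦ0 : 0 ≤ 6 * (561 ^ d * jl * Lu + 1122 ^ d * Lu) * (cΛ * M ^ d) := by positivity
  have hle : ∀ j, j ≤ K →
      1 ≤ ell g j ∧ (6 * (561 ^ d * jl * Lu + 1122 ^ d * Lu) * (cΛ * M ^ d) / C.E₂) ^ ((1 : ℝ) / κ₂) ≤ ell g j ∧
      (15 * 126 ^ d * (cΛ * M ^ d) / C.E₂) ^ ((1 : ℝ) / κ₂) ≤ ell g j ∧ (24 * 126 ^ d * (cΛ * M ^ d) / C.E₃) ^ ((1 : ℝ) / κ₂) ≤ ell g j ∧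
      (2 ^ (d + 3) * (cΛ * (L * M) ^ d) / (θv * C.A₀ ^ 2)) ^ ((1 : ℝ) / κᵥ) ≤ ell g j := fun j hj => by
    have h := hwin j hj; simp only [ellVolL, max_le_iff] at h; exact ⟨h.1, h.2.1.1, h.2.1.2, h.2.2.1, h.2.2.2⟩
  refine ⟨hexpF, hdq, hexpV, fun j hj => (hle j hj).1, fun j hj => ?_, fun j hj => ?_, fun j hj => ?_, fun j hj => ?_⟩
  · have h := le_pow_of_rpow_inv_le (div_nonneg hΦ0 hE₂.le) hκ₂ (hle j hj).2.1; rw [div_le_iff₀ hE₂] at h; linarith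
  · have h := le_pow_of_rpow_inv_le (div_nonneg (by positivity) hE₂.le) hκ₂ (hle j hj).2.2.1; rw [div_le_iff₀ hE₂] at h; linarith
  · have h := le_pow_of_rpow_inv_le (div_nonneg (by positivity) hE₃.le) hκ₂ (hle j hj).2.2.2.1; rw [div_le_iff₀ hE₃] at h; linarith
  · have h := le_pow_of_rpow_inv_le (div_nonneg (by positivity) hA2.le) hκᵥ (hle j hj).2.2.2.2; rw [div_le_iff₀ hA2] at h; linarith

/-- **THE LATTICE WINDOW FROM THE COUPLINGS**: `0 < g_j ≤ γ ≤ e^{−ℓᵥᴸ∕2}` on the performed range gives the window. [folklore] -/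
theorem volumeWindowL_of_couplings {γ : ℝ} (hexpF : 1 + κ₂ = r * (C.q' - d)) (hdq : d ≤ C.q')
    (hexpV : 1 + r * d + κᵥ = 2 * C.p₀) (hκ₂ : 1 ≤ κ₂) (hκᵥ : 1 ≤ κᵥ) (hc : 0 ≤ cΛ) (hM : 0 ≤ M) (hE₂ : 0 < C.E₂)
    (hE₃ : 0 < C.E₃) (hθ : 0 < θv) (hA₀ : C.A₀ ≠ 0) (hLu : 0 ≤ Lu) (hγ : γ ≤ Real.exp (-(ellVolL C d κ₂ κᵥ cΛ M L θv Lu jl / 2)))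
    (hg : ∀ j, j ≤ K → 0 < g j ∧ g j ≤ γ) : VolumeWindowL C d K r κ₂ κᵥ cΛ M L θv Lu jl g :=
  volumeWindowL_of_threshold hexpF hdq hexpV hκ₂ hκᵥ hc hM hE₂ hE₃ hθ hA₀ hLu
    fun j hj => le_ell_of_coupling (hg j hj).1 (hg j hj).2 hγ

/-- the lattice threshold's coupling bound is positive (the `ForSmallCouplings` outer threshold takes the `min` with). [folklore] -/
theorem exp_neg_ellVolL_pos (C : T4PrintedShapeBanking.Consts) (d κ₂ κᵥ : ℕ) (cΛ M : ℝ) (L : ℕ) (θv Lu : ℝ) (jl : ℕ) :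
    0 < Real.exp (-(ellVolL C d κ₂ κᵥ cΛ M L θv Lu jl / 2)) := Real.exp_pos _

end Threshold

/-! ## §6 The one-call form and the prefix forms (the fillers an LW-record variant consumes) -/
section Prefix

variable {C : T4PrintedShapeBanking.Consts} {d K r κ₂ κᵥ p L : ℕ} {cΛ M θv β' β'' β₀ β₀'' γ : ℝ} {g : ℕ → ℝ} {R : ℕ → ℕ}

/-- **THE CALIBRATION AT THE LATTICE LETTER FROM THE COUPLINGS, (2.7), (2.9) AND (2.5)** (one call; every coupling
`0 < g_j ≤ γ ≤ e^{−ℓᵥᴸ∕2}`, `ℓᵥᴸ` read at `Lu := (1+β₀)·L^d`, `jl := jvol d Lu`). [folklore] -/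
theorem volumeDisplaysL_sharp_of_couplings (hexpF : 1 + κ₂ = r * (C.q' - d)) (hdq : d ≤ C.q')
    (hexpV : 1 + r * d + κᵥ = 2 * C.p₀) (hκ₂ : 1 ≤ κ₂) (hκᵥ : 1 ≤ κᵥ) (hc : 0 ≤ cΛ) (hM : 0 ≤ M) (hL : 1 ≤ L)
    (hE₂ : 0 < C.E₂) (hE₃ : 0 < C.E₃) (hθ : 0 < θv) (hA₀ : C.A₀ ≠ 0) (hβ₀ : 0 ≤ β₀) (hp : 1 ≤ p)
    (h27 : B14.FlowIneq27 g β' β₀ p K) (h29 : B14FlowStep.FlowIneq29 R g L β'' β₀'' K)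
    (hRj : ∀ t, t ≤ K → B14.IsRj L r (g t) (R t))
    (hγ : γ ≤ Real.exp (-(ellVolL C d κ₂ κᵥ cΛ M L θv ((1 + β₀) * L ^ d) (jvol d ((1 + β₀) * L ^ d)) / 2)))
    (hg : ∀ j, j ≤ K → 0 < g j ∧ g j ≤ γ) :
    VolumeDisplays C d K R (uvolL cΛ M d g R K) ((1 + β₀) * L ^ d) (jvol d ((1 + β₀) * L ^ d)) :=
  volumeDisplaysL_sharp_of_isRj hp h27 h29 hβ₀ hc hM hL hE₂.le hE₃.le hRj
    (volumeWindowL_of_couplings hexpF hdq hexpV hκ₂ hκᵥ hc hM hE₂ hE₃ hθ hA₀ (by positivity) hγ hg)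

/-- **THE RECORD's SEVEN FIELDS FOR A COST PINNED BY THE DISPLAY `hΛ`, FROM `Flow.InInterval`** (the filler an LW-record variant with
`hΛL : ∀ t, log (Λ t) = uvolL cΛ M d (flow.g) (ℛ.R K) K t` consumes; `hI` the prefix's interval clause at the lattice threshold;
`h27`, `h29`, `isRj` the record's flow rows). [folklore] -/
theorem volumeDisplaysL_of_log_eq_of_inInterval (Fl : Flow) (hI : Fl.InInterval γ K) {Λ : ℕ → ℝ}
    (hΛ : ∀ t, Real.log (Λ t) = uvolL cΛ M d Fl.g R K t) (hexpF : 1 + κ₂ = r * (C.q' - d)) (hdq : d ≤ C.q')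
    (hexpV : 1 + r * d + κᵥ = 2 * C.p₀) (hκ₂ : 1 ≤ κ₂) (hκᵥ : 1 ≤ κᵥ) (hc : 0 ≤ cΛ) (hM : 0 ≤ M) (hL : 1 ≤ L)
    (hE₂ : 0 < C.E₂) (hE₃ : 0 < C.E₃) (hθ : 0 < θv) (hA₀ : C.A₀ ≠ 0) (hβ₀ : 0 ≤ β₀) (hp : 1 ≤ p)
    (h27 : B14.FlowIneq27 Fl.g β' β₀ p K) (h29 : B14FlowStep.FlowIneq29 R Fl.g L β'' β₀'' K)
    (hRj : ∀ t, t ≤ K → B14.IsRj L r (Fl.g t) (R t))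
    (hγ : γ ≤ Real.exp (-(ellVolL C d κ₂ κᵥ cΛ M L θv ((1 + β₀) * L ^ d) (jvol d ((1 + β₀) * L ^ d)) / 2))) :
    VolumeDisplays C d K R (fun t => Real.log (Λ t)) ((1 + β₀) * L ^ d) (jvol d ((1 + β₀) * L ^ d)) := by
  rw [show (fun t => Real.log (Λ t)) = uvolL cΛ M d Fl.g R K from funext hΛ]
  exact volumeDisplaysL_sharp_of_couplings hexpF hdq hexpV hκ₂ hκᵥ hc hM hL hE₂ hE₃ hθ hA₀ hβ₀ hp h27 h29 hRj hγ
    fun j hj => hI j hj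

/-- **`huV` OVER A MEMBER's KIND-`0` EVENTS FOR A COST PINNED BY `hΛ`, FROM `Flow.InInterval`** (the `huV` filler: births at
performed steps `hsteps`; threshold read at any calibration `Lu ≥ 0`, `jl`; upper (2.5) member from `isRj`, `L ≥ 1`). [folklore] -/
theorem huVL_events_of_log_eq_of_inInterval (Fl : Flow) (hI : Fl.InInterval γ K) {Λ : ℕ → ℝ} {Lu : ℝ} {jl : ℕ}
    (hΛ : ∀ t, Real.log (Λ t) = uvolL cΛ M d Fl.g R K t) (hexpF : 1 + κ₂ = r * (C.q' - d)) (hdq : d ≤ C.q')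
    (hexpV : 1 + r * d + κᵥ = 2 * C.p₀) (hκ₂ : 1 ≤ κ₂) (hκᵥ : 1 ≤ κᵥ) (hc : 0 ≤ cΛ) (hM : 0 ≤ M) (hL : 1 ≤ L)
    (hE₂ : 0 < C.E₂) (hE₃ : 0 < C.E₃) (hθ : 0 < θv) (hA₀ : C.A₀ ≠ 0) (hLu : 0 ≤ Lu)
    (hRj : ∀ t, t ≤ K → B14.IsRj L r (Fl.g t) (R t)) (hγ : γ ≤ Real.exp (-(ellVolL C d κ₂ κᵥ cΛ M L θv Lu jl / 2)))
    {ε : Type*} (sh : ε → PEv) (E : Finset ε) (hsteps : ∀ e ∈ E, (sh e).kind = 0 → (sh e).step ≤ K) :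
    ∀ e ∈ E, (sh e).kind = 0 → 2 ^ (d + 3) * Real.log (Λ (sh e).step) ≤ θv * p0Profile C.A₀ C.p₀ (Fl.g (sh e).step) ^ 2 :=
  have hW := volumeWindowL_of_couplings hexpF hdq hexpV hκ₂ hκᵥ hc hM hE₂ hE₃ hθ hA₀ hLu hγ fun j hj => hI j hj
  huVL_events_of_log_eq hΛ hW hc hM (fun t ht => (envelope_of_isRj hL (hRj t ht) (hW.one_le_ell t ht)).1) sh E hsteps

end Prefix

end

end Summit.QuantumFields.BalabanUV.T4Continuum.HistoryBankingVolumeWindowLattice
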